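import Summits.QuantumFields.YangMills.Theorems.PencilRigidityDiagonalMirrorRPRStubFortyFiveSwapRP
import Summits.QuantumFields.YangMills.Theorems.PencilRigidityDiagonalMirrorRPRStubRpClosureOffDiag

/-!
# Crux `DiagonalMirrorRPR` (stmt-QuantumFields-10604): the reduction to cover transport, and the closing theorem
# for the restated crux

Crux `DiagonalMirrorRPR` of the routes `PencilRigidity` (#5) and `MirrorModularBoosts` (#4) of `YangMills` (shared
verbatim; `Summit.QuantumFields.YangMills.Theses.MirrorModularBoosts.DiagonalMirrorRPR`): for every compact simple `G`,
lattice representation `r`, scheme `sch` and one-species family `S₁` with the curvature package `W₁ r sch S₁`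
(`CurvaturePackage`), `S₁` is reflection positive in pull-back form in the four diagonal frames (`DiagonalFrameRP`).

This file composes the two LANDED halves of the line `parity-bridge-cold-traces` —
`stub_fortyFiveSwapRP` (exact swap reflection positivity of Wilson's measure on the Fröhlich–Israel–Lieb–Simon 45°
torus, `…StubFortyFiveSwapRP`) and `stub_rpClosureOffDiag` (the Osterwalder–Schrader limit closure from cover
insensitivity on off-diagonal compact real families, `…StubRpClosureOffDiag`) — into the statements the planners need:

* `Reduction.diagonalFrameRP_of_coverInsensitivityOffDiag`: `CurvaturePackage r sch S₁`, `0 ≤ β_k` EVENTUALLY and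
  `CoverInsensitivityOffDiag r sch` imply `DiagonalFrameRP S₁` (shift the scheme past its last negative coupling — the
  package and cover insensitivity are tail-invariant — then S1 on every cover and S4').
* `Reduction.DiagonalMirrorRPR_of_coverTransport`: the crux follows from the TRANSPORT statement
  (`W₁ → (∀ᶠ k, 0 ≤ β_k) → CoverInsensitivityOffDiag`) and the SCOPE statement (the crux on schemes with `β_k < 0`
  frequently) — the composition of the reshaped skeleton `Cruxes/DiagonalMirrorRPR/Lines/parity_bridge_cold_traces.lean`.
* `Reduction.coverInsensitivityOffDiag_of_coverConvergence` and `Reduction.diagonalFrameRP_of_coverConvergence`: if the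
  lattice curvature strings ALSO converge to `S₁` on the 45° covers (the clause recommended for `W₁`), cover
  insensitivity — hence the conclusion of the crux — follows outright for eventually non-negative couplings.  This is the
  closing theorem of the recommended restatement `W₁ ∧ (∀ᶠ k, 0 ≤ β_k) ∧ cover-convergence ⇒ DiagonalFrameRP`.

No new definitions (the shifted scheme is a local structure instance).  References: Fröhlich–Israel–Lieb–Simon,
Comm. Math. Phys. 62 (1978) Thm 2.1 and J. Stat. Phys. 22 (1980) §3; Osterwalder–Schrader, Comm. Math. Phys. 31 (1973)
§2–3; Osterwalder–Seiler, Ann. Phys. 110 (1978) §2.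
-/

set_option autoImplicit false

noncomputable section

open scoped SchwartzMap ComplexConjugate
open MeasureTheory Filter Topology
open Literature.MathematicalPhysics.QuantumLattice Literature.MathematicalPhysics.AQFT
  Literature.MathematicalPhysics.QuantumFieldTheory

namespace Summit.QuantumFields.YangMills.Cruxes.DiagonalMirrorRPR.ParityBridgeColdTraces.Reduction

variable {G : Type} [Group G] [TopologicalSpace G] [IsTopologicalGroup G] [CompactSpace G]
  [MeasurableSpace G] [BorelSpace G]

/-! ## §1 Tail shift: discarding finitely many couplings -/

/-- **Shift lemma.** If the package holds along `sch` and cover insensitivity (off-diagonal) holds along `sch`, then for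
every `k₀` there is a scheme `sch'` (the tail `k ↦ sch (k + k₀)`) carrying the package, with `sch'.β k = sch.β (k + k₀)`,
`sch'.side k = sch.side (k + k₀)`, and cover insensitivity — all that the closure S4' consumes. -/
theorem exists_shift (r : LatticeRep G) (sch : SpeciesScheme (YMSpecies G)) (S₁ : SchwingerFamily E4)
    (hW : CurvaturePackage r sch S₁) (hCI : CoverInsensitivityOffDiag r sch) (k₀ : ℕ) :
    ∃ sch' : SpeciesScheme (YMSpecies G), (∀ k, sch'.β k = sch.β (k + k₀)) ∧
      CurvaturePackage r sch' S₁ ∧ CoverInsensitivityOffDiag r sch' := by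
  let sch' : SpeciesScheme (YMSpecies G) :=
    { a := fun k => sch.a (k + k₀)
      a_pos := fun k => sch.a_pos (k + k₀)
      tendsto_a := sch.tendsto_a.comp (tendsto_add_atTop_nat k₀)
      β := fun k => sch.β (k + k₀)
      L := fun k => sch.L (k + k₀)
      tendsto_L := sch.tendsto_L.comp (tendsto_add_atTop_nat k₀)
      c := fun s k => sch.c s (k + k₀)
      m := fun s k => sch.m s (k + k₀) }
  have hlat : ∀ (k n : ℕ) (f : Fin n → 𝓢(E4, ℝ)),
      latticeSchwinger r.ρ sch' (fun s => s.F) k n (fun _ => r.curvature) f =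
        latticeSchwinger r.ρ sch (fun s => s.F) (k + k₀) n (fun _ => r.curvature) f := fun _ _ _ => rfl
  have hcov : ∀ (k n : ℕ) (f : Fin n → 𝓢(E4, ℝ)),
      coverSchwinger r sch' k n f = coverSchwinger r sch (k + k₀) n f := fun _ _ _ => rfl
  refine ⟨sch', fun _ => rfl, ?_, ?_⟩
  · obtain ⟨hconv, hOS, htr, hrot, Δ, hΔ, hgap, hlg⟩ := hW
    refine ⟨fun n hn f F hT hO => ?_, hOS, htr, hrot, Δ, hΔ, hgap, fun A B => ?_⟩
    · have h := (hconv n hn f F hT hO).comp (tendsto_add_atTop_nat k₀)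
      refine h.congr fun k => ?_
      simp only [Function.comp_apply, hlat]
    · obtain ⟨C, hC⟩ := hlg A B
      exact ⟨C, (tendsto_add_atTop_nat k₀).eventually hC⟩
  · intro n hn f hcs hdisj
    have h := (hCI n hn f hcs hdisj).comp (tendsto_add_atTop_nat k₀)
    refine h.congr fun k => ?_
    simp only [Function.comp_apply, hlat, hcov]

/-! ## §2 The reduction of the crux to cover transport -/

/-- **Reduction.** For a compact simple `G`: the curvature package, eventually non-negative couplings and cover
insensitivity on off-diagonal compact real families imply reflection positivity of `S₁` in pull-back form in every
diagonal frame.  Proof: shift the scheme past its last negative coupling (`exists_shift`); on the shifted scheme every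
cover `T̃_{N_k}`, `N_k ≥ 2`, is swap-RP by `stub_fortyFiveSwapRP` (β ≥ 0); close with `stub_rpClosureOffDiag`. -/
theorem diagonalFrameRP_of_coverInsensitivityOffDiag (hG : IsCompactSimpleLieGroup G) (r : LatticeRep G)
    (sch : SpeciesScheme (YMSpecies G)) (S₁ : SchwingerFamily E4) (hW : CurvaturePackage r sch S₁)
    (hβ : ∀ᶠ k in atTop, 0 ≤ sch.β k) (hCI : CoverInsensitivityOffDiag r sch) : DiagonalFrameRP S₁ := by
  obtain ⟨k₀, hk₀⟩ := eventually_atTop.1 hβ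
  obtain ⟨sch', hβeq, hW', hCI'⟩ := exists_shift r sch S₁ hW hCI k₀
  have hβ' : ∀ k, 0 ≤ sch'.β k := fun k => by rw [hβeq]; exact hk₀ (k + k₀) (Nat.le_add_left k₀ k)
  have hRP : ∀ k, 2 ≤ sch'.side k → CoverSwapRPAt r.ρ (sch'.β k) (sch'.side k) :=
    fun k hk => stub_fortyFiveSwapRP G r.N r.ρ r.continuous r.mem_unitary _ (hβ' k) _ hk
  exact stub_rpClosureOffDiag G hG r sch' S₁ hW' hβ' hRP hCI'

/-- **The crux from transport + scope** (the composition of the reshaped skeleton, landed).  If (transport) the package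
with eventually non-negative couplings gives cover insensitivity on off-diagonal families, and (scope) the crux holds for
schemes with `β_k < 0` for infinitely many `k`, then `DiagonalMirrorRPR` holds (the `MirrorModularBoosts` copy, shared
verbatim with the `PencilRigidity` copy). -/
theorem DiagonalMirrorRPR_of_coverTransport
    (hT : ∀ (G : Type) [Group G] [TopologicalSpace G] [IsTopologicalGroup G] [CompactSpace G]
      [MeasurableSpace G] [BorelSpace G], IsCompactSimpleLieGroup G →
      ∀ (r : LatticeRep G) (sch : SpeciesScheme (YMSpecies G)) (S₁ : SchwingerFamily E4),
        CurvaturePackage r sch S₁ → (∀ᶠ k in atTop, 0 ≤ sch.β k) → CoverInsensitivityOffDiag r sch)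
    (hS : ∀ (G : Type) [Group G] [TopologicalSpace G] [IsTopologicalGroup G] [CompactSpace G]
      [MeasurableSpace G] [BorelSpace G], IsCompactSimpleLieGroup G →
      ∀ (r : LatticeRep G) (sch : SpeciesScheme (YMSpecies G)) (S₁ : SchwingerFamily E4),
        CurvaturePackage r sch S₁ → (∃ᶠ k in atTop, sch.β k < 0) → DiagonalFrameRP S₁) :
    Summit.QuantumFields.YangMills.Theses.MirrorModularBoosts.DiagonalMirrorRPR := by
  -- readback: the decl is definitionally `∀ G simple, r, sch, S₁: CurvaturePackage → DiagonalFrameRP`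
  have hiff : Summit.QuantumFields.YangMills.Theses.MirrorModularBoosts.DiagonalMirrorRPR ↔
      ∀ (G : Type) [Group G] [TopologicalSpace G] [IsTopologicalGroup G] [CompactSpace G],
        IsCompactSimpleLieGroup G →
          letI : MeasurableSpace G := borel G
          haveI : BorelSpace G := ⟨rfl⟩
          ∀ (r : LatticeRep G) (sch : SpeciesScheme (YMSpecies G)) (S₁ : SchwingerFamily E4),
            CurvaturePackage r sch S₁ → DiagonalFrameRP S₁ := Iff.rfl
  refine hiff.mpr ?_
  intro G _ _ _ _ hG
  letI : MeasurableSpace G := borel G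
  haveI : BorelSpace G := ⟨rfl⟩
  intro r sch S₁ hW
  by_cases hev : ∀ᶠ k in atTop, 0 ≤ sch.β k
  · exact diagonalFrameRP_of_coverInsensitivityOffDiag hG r sch S₁ hW hev (hT G hG r sch S₁ hW hev)
  · have hneg : ∃ᶠ k in atTop, sch.β k < 0 := by
      simpa only [Filter.not_eventually, not_le] using hev
    exact hS G hG r sch S₁ hW hneg

/-- **Registered sub-goal `stub_reduction_coverTransport`** (the composition of the reshaped skeleton
`Cruxes/DiagonalMirrorRPR/Lines/parity_bridge_cold_traces.lean`, verbatim): transport ∧ scope ⇒ the crux. -/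
theorem stub_reduction_coverTransport : (∀ (G : Type) [Group G] [TopologicalSpace G] [IsTopologicalGroup G] [CompactSpace G] [MeasurableSpace G] [BorelSpace G], IsCompactSimpleLieGroup G → ∀ (r : LatticeRep G) (sch : SpeciesScheme (YMSpecies G)) (S₁ : SchwingerFamily E4), CurvaturePackage r sch S₁ → (∀ᶠ k in atTop, 0 ≤ sch.β k) → CoverInsensitivityOffDiag r sch) → (∀ (G : Type) [Group G] [TopologicalSpace G] [IsTopologicalGroup G] [CompactSpace G] [MeasurableSpace G] [BorelSpace G], IsCompactSimpleLieGroup G → ∀ (r : LatticeRep G) (sch : SpeciesScheme (YMSpecies G)) (S₁ : SchwingerFamily E4), CurvaturePackage r sch S₁ → (∃ᶠ k in atTop, sch.β k < 0) → DiagonalFrameRP S₁) → Summit.QuantumFields.YangMills.Theses.MirrorModularBoosts.DiagonalMirrorRPR :=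
  fun hT hS => DiagonalMirrorRPR_of_coverTransport hT hS

/-! ## §3 The closing theorem for the restated crux (cover convergence in `W₁`) -/

/-- A tensor product of complexified real test functions with pairwise disjoint supports is off-diagonal (`∈ ⁰𝒮`):
its support lies in the product of the supports, which misses the coincidence locus. -/
theorem isOffDiagonal_of_isTensorOf_of_disjoint {n : ℕ} {F : 𝓢((Fin n → E4), ℂ)} {f : Fin n → 𝓢(E4, ℝ)}
    (hF : IsTensorOf F fun i => ofRealTest (f i))
    (hdisj : ∀ i j, i ≠ j → Disjoint (tsupport (f i : E4 → ℝ)) (tsupport (f j : E4 → ℝ))) :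
    IsOffDiagonal F := by
  refine IsOffDiagonal.of_tsupport_subset fun x hx hxc => ?_
  obtain ⟨i, j, hij, hxij⟩ := (mem_coincidenceLocus x).1 hxc
  have hsub : ∀ l, tsupport (ofRealTest (f l) : E4 → ℂ) ⊆ tsupport (f l : E4 → ℝ) := fun l => by
    refine closure_mono fun y hy => ?_
    rw [Function.mem_support] at hy ⊢
    intro h0
    exact hy (by rw [ofRealTest_apply, h0, Complex.ofReal_zero])
  have hi : x i ∈ tsupport (f i : E4 → ℝ) := hsub i (hF.tsupport_subset hx i)
  have hj : x j ∈ tsupport (f j : E4 → ℝ) := hsub j (hF.tsupport_subset hx j)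
  rw [hxij] at hi
  exact Set.disjoint_left.1 (hdisj i j hij) hi hj

/-- **Cover convergence ⇒ cover insensitivity.** If, along the scheme, the curvature strings computed on the 45°
covers converge to `S₁` on off-diagonal real tensors (the clause recommended for `W₁`, parallel to `hconv`), then the
torus and cover strings of pairwise-disjoint compactly supported real families have difference `→ 0`. -/
theorem coverInsensitivityOffDiag_of_coverConvergence (r : LatticeRep G) (sch : SpeciesScheme (YMSpecies G))
    (S₁ : SchwingerFamily E4) (hW : CurvaturePackage r sch S₁)
    (hcc : ∀ (n : ℕ), n ≠ 0 → ∀ (f : Fin n → 𝓢(E4, ℝ)) (F : 𝓢((Fin n → E4), ℂ)),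
      IsTensorOf F (fun i => ofRealTest (f i)) → IsOffDiagonal F →
        Tendsto (fun k : ℕ => ((coverSchwinger r sch k n f : ℝ) : ℂ)) atTop (𝓝 (S₁ n F))) :
    CoverInsensitivityOffDiag r sch := by
  intro n hn f _ hdisj
  obtain ⟨hconv, -⟩ := hW
  have hT : IsTensorOf (SchwartzMap.tensorFin n fun i => ofRealTest (f i)) fun i => ofRealTest (f i) :=
    isTensorOf_tensorFin _
  have hO : IsOffDiagonal (SchwartzMap.tensorFin n fun i => ofRealTest (f i)) :=
    isOffDiagonal_of_isTensorOf_of_disjoint hT hdisj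
  have h1 := (Complex.continuous_re.tendsto _).comp (hconv n hn f _ hT hO)
  have h2 := (Complex.continuous_re.tendsto _).comp (hcc n hn f _ hT hO)
  have h3 := h1.sub h2
  rw [sub_self] at h3
  refine h3.congr fun k => ?_
  simp only [Function.comp_apply, Complex.ofReal_re]

/-- **Closing theorem of the restated crux.** For a compact simple `G`: the curvature package `W₁`, eventually
non-negative couplings and lattice convergence on the 45° covers imply reflection positivity of `S₁` in pull-back form
in the four diagonal frames `R e₀ = (±e₀ ± e₁)/√2`. -/
theorem diagonalFrameRP_of_coverConvergence (hG : IsCompactSimpleLieGroup G) (r : LatticeRep G)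
    (sch : SpeciesScheme (YMSpecies G)) (S₁ : SchwingerFamily E4) (hW : CurvaturePackage r sch S₁)
    (hβ : ∀ᶠ k in atTop, 0 ≤ sch.β k)
    (hcc : ∀ (n : ℕ), n ≠ 0 → ∀ (f : Fin n → 𝓢(E4, ℝ)) (F : 𝓢((Fin n → E4), ℂ)),
      IsTensorOf F (fun i => ofRealTest (f i)) → IsOffDiagonal F →
        Tendsto (fun k : ℕ => ((coverSchwinger r sch k n f : ℝ) : ℂ)) atTop (𝓝 (S₁ n F))) :
    DiagonalFrameRP S₁ :=
  diagonalFrameRP_of_coverInsensitivityOffDiag hG r sch S₁ hW hβ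
    (coverInsensitivityOffDiag_of_coverConvergence r sch S₁ hW hcc)

end Summit.QuantumFields.YangMills.Cruxes.DiagonalMirrorRPR.ParityBridgeColdTraces.Reduction

end
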